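import Summits.BirchSwinnertonDyer.BirchSwinnertonDyer.Theses.AdditiveBranchIMC
import Summits.BirchSwinnertonDyer.Rank1Residual.Additive.X3BranchGordEndStateIntrinsic
import Summits.BirchSwinnertonDyer.Rank1Residual.Additive.LocalTowerKernelAtPTwistedOrdinaryTwo
import Summits.BirchSwinnertonDyer.Rank1Residual.Additive.ChiBranchLowerTransportGord
import Summits.BirchSwinnertonDyer.Rank1Residual.Additive.ChiBranchLowerInputOdd
import Summits.BirchSwinnertonDyer.Rank1Residual.Additive.CycLeadingTermDvdIff
import Summits.BirchSwinnertonDyer.Rank1Residual.Additive.N10TwistClauseBSTW121c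
import HarnessLib

/-!
# Crux `GordTwoRankZeroOffCaseOne` (route `AdditiveBranchIMC`, item 19357): the TRANSPORT half, proved —
# the crux and both registered stubs of `Cruxes/GordTwoRankZeroOffCaseOne/Lines/birth.lean` reduced to
# EXACTLY the main-conjecture lower bound on the `ω^{(p−1)/2}`-branch, from the route's named facts

Cell `bsd-addord`, seat `bsd-addord-k1-c2` (D-0074 row B1: «the IMC lower bound on the twisted branch +
transport»). HONEST FRAMING: nothing here proves the Birch–Swinnerton-Dyer conjecture or the crux; every
published input is an explicit named-fact binder (the route's `PrintedFacts` / `ReadingFacts` conjuncts,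
by name), and the ONE unpublished input — the `⊆ (𝓛)` direction of the Iwasawa main conjecture of the good
ordinary twist `E♭ = E^{(p*)}` on the `ω^{(p−1)/2}`-branch (equivalently Kato's main conjecture for the
newform `f_E = f_{E♭} ⊗ χ_{p*}`), in the tree's typed currencies `CycLowerLeadingTermAt` (`T = 0`,
parity-free), `ChiBranchLowerLeadingTerm[Odd]At` (`T = 0`, on the branch) and
`ChiBranchLowerDivisibility[Odd]At` (Λ-adic, on the branch) — is DISPLAYED as a hypothesis, never asserted.
It is in print at NO additive pair (Skinner–Urban 2014 Thm. 3.6.4 / Cor. 3.6.3: nebentypus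
`ω^{k−2}χ₁` with `χ₁` of `p`-power order only, i.e. the trivial tame branch in weight `2`, pp. 42–43 of
the author version; Wan 2015: `p` unramified in the totally real field, here `p ∣ d_{ℚ(√p*)}`;
Greenberg–Vatsal 2000 / Castella–Grossi–Skinner: good ordinary `p`, trivial branch of `E♭`;
Burungale–Skinner–Tian–Wan arXiv:2409.01350v2 Thm. 9.21(c) twist clause and Fouquet–Wan arXiv:2107.13726
Thm. 5.1 / Cor. 5.4: unrefereed claims, typed in the tree as OPEN hypotheses only).

## What is proved (theorems only; no definition, no new named fact)

* §1 `exactLeadingTermAt_of_prop4Intrinsic_of_typeGOrd` — **the exact rank-0 algebraic leading term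
  `ExactLeadingTermAt W p` on the WHOLE additive (G)-ordinary locus, every odd `p`, IMAGE-FREE, anomalous
  and CM rows included**: Delbourgo 1998 Thm. 3 + Prop. 4 in intrinsic form (`hDelG`, the route's
  `ReadingFacts` conjunct `Delbourgo1998.prop4_rankZero_constantCoeff_eq_unit_mul_of_potGoodOrd`) with
  the local tower kernel `𝒦_{ℚ_p,0}[p^∞]` killed by the tree (`GoodModelLine.ClassX4Gord/ClassX3Gord.
  localTowerKerPrimary_zero_eq_bot`, Greenberg LNM 1716 Lemma 3.4 / Prop. 3.8 on the good ordinary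
  twist model). The X3♯ case is p404507's `ClassX3Gord.exactLeadingTermAt_of_prop4Intrinsic`; the X4♯
  case is new, and removes the inputs `hna` (non-anomalous), `hcm` (non-CM) and `p ≥ 5` that the
  Delbourgo-2002 transport `N10.missingLowerBoundAt_of_cycLowerLeadingTerm_of_nonAnomalous` carries.
* §2 `missingLowerBoundAt_rankZero_of_cycLowerLeadingTerm_of_typeGOrd` and its branch forms — **the
  lower half `ord_p #Ш(E)_an ≤ ord_p #Ш(E)` in analytic rank `0` on the additive (G)-ordinary locus from
  the ONE typed input**, in each currency: `CycLowerLeadingTermAt W p` (any defect — so also the rank-0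
  part of the residual crux `GordHigherLower`), `ChiBranchLowerLeadingTermAt W p` (`e = 2`,
  `p ≡ 1 (mod 4)`, Birch + Pal 2012 `hPal`), `ChiBranchLowerLeadingTermOddAt W p` (`e = 2`,
  `p ≡ 3 (mod 4)`, `p = 3` included), `ChiBranchLowerDivisibility[Odd]At W p` (Λ-adic ⟹ `T = 0` by
  Mazur–Tate–Teitelbaum §I.14, tree theorems `chiBranchLowerLeadingTerm[Odd]At_of_divisibility[Odd]_…`).
* §3 the ROUTE-FACING forms: `gordTwoRankZeroOffCaseOne_of_cycLowerLeadingTerm` concludes the crux decl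
  `Theses.AdditiveBranchIMC.GordTwoRankZeroOffCaseOne` BY NAME from the named facts and the displayed
  branch input on the off-Case-1 rows; `stubIrreducible_of_cycLowerLeadingTerm` /
  `stubReducibleNoCaseOne_of_cycLowerLeadingTerm` are the two registered stubs' statements VERBATIM as
  conclusions; `gordTwoRankZeroOffCaseOne_of_chiBranchLowerLeadingTerm` /
  `gordTwoRankZeroOffCaseOne_of_chiBranchLowerDivisibility` are the same in the branch currencies (the
  route's TWO-LAYER PLAN glue `chiBranchLowerLeadingTermAt_of_divisibility_of_padicValRat_j_nonneg ∘ …`,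
  kernel-checked). So crux 19357 IS the branch lower bound and nothing else: every other input of the
  cell's rank-0 end states (period, control, local tower kernel, Cassels, GZK, modularity) is discharged.
* §4 what the ONE announced source would give, with the §1 improvement: IF the BSTW Thm. 9.21(c) twist
  clause (tree OPEN hypothesis `BurungaleSkinnerTianWan2024_thm121c_twist_cycLower_OPEN`, unrefereed)
  holds, `stub_irreducible` holds on its slice {`p ≥ 5`, a (ram) prime} — ANOMALOUS AND CM ROWS NOW
  INCLUDED (`stubIrreducible_slice_of_BSTW921c_twist_OPEN`); the complement of the slice inside the
  irreducible rows (`p = 3`; no (ram) prime) and all reducible off-Case-1 rows (Greenberg–Vatsal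
  `μ`-territory on the branch) have NO printed or announced source: they keep the displayed input.

References: D. Delbourgo, Compositio Math. 113 (1998) Thm. 3 (p. 143), Prop. 4 (p. 144), Main Conjecture
(p. 151) [Delbourgo1998]; R. Greenberg, LNM 1716 (1999) Lemma 3.4, Prop. 3.8 [GreenbergLNM1716];
B. Mazur, J. Tate, J. Teitelbaum, Invent. Math. 84 (1986) §I.14 [MazurTateTeitelbaum1986Invent]; V. Pal,
Proc. AMS 140 (2012) Thm. 3.2 [Pal2012]; C. Skinner, E. Urban, Invent. Math. 195 (2014) Cor. 3.6.3,
Thm. 3.6.4 [SkinnerUrban2014]; A. Burungale, C. Skinner, Y. Tian, X. Wan, arXiv:2409.01350v2 Thm. 9.21(c)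
[BurungaleSkinnerTianWan2024]; R. L. Miller, LMS J. Comput. Math. 14 (2011) Def. 1.1 [Miller2011LMS].
-/

set_option autoImplicit false
set_option linter.dupNamespace false

noncomputable section

open scoped Classical

open WeierstrassCurve NumberField IsDedekindDomain
  Literature.NumberTheory.EllipticCurves
  Literature.NumberTheory.EllipticCurves.ModularForms
  Literature.NumberTheory.EllipticCurves.Rank1Residual
  Literature.NumberTheory.EllipticCurves.Rank1Residual.Typed
  Literature.NumberTheory.GaloisRepresentations

namespace Summit.BirchSwinnertonDyer.BirchSwinnertonDyer.Theorems.AdditiveBranchIMCGordTwoRankZeroTransport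

open Summit.BirchSwinnertonDyer.Rank1Residual.Additive
open Summit.BirchSwinnertonDyer.BirchSwinnertonDyer.Theses.AdditiveBranchIMC

variable {W : WeierstrassCurve ℚ} [W.IsElliptic] [W.IsGloballyMinimal] {p : ℕ} [hp : Fact p.Prime]

/-! ## §1 The exact rank-0 leading term on the whole additive (G)-ordinary locus (image-free) -/

/-- **`ExactLeadingTermAt W p` on the additive (G)-ordinary locus, every odd `p`, `r_an = 0` — X3 and X4
rows, anomalous and CM rows alike.** Delbourgo 1998 Thm. 3 + Prop. 4 in intrinsic form (`hDelG`:
`g(0)·#E(ℚ)² = u·#Ш(E)(p)·#𝒦₀·∏_{ν≠p} c_ν` with `𝒦₀ = W.localTowerKerPrimary κ ℚ_v 0`) and the tree's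
kernel theorems `GoodModelLine.ClassX4Gord.localTowerKerPrimary_zero_eq_bot` /
`GoodModelLine.ClassX3Gord.localTowerKerPrimary_zero_eq_bot` (`𝒦₀ = ⊥` on the good ordinary twist
model, so `#𝒦₀ = 1`); `E(ℚ)` and `Ш(E)` finite by Gross–Zagier–Kolyvagin (`hGZK`).
[cite: Delbourgo1998, Thm. 3 (p. 143) and Prop. 4 (p. 144)]
[cite: GreenbergLNM1716, §3 Lemma 3.4 (p. 89) and Prop. 3.8 (p. 95)] -/
theorem exactLeadingTermAt_of_prop4Intrinsic_of_typeGOrd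
    (hDelG : Delbourgo1998.prop4_rankZero_constantCoeff_eq_unit_mul_of_potGoodOrd)
    (hGZK : rank_eq_analyticRank_of_analyticRank_le_one)
    (hp2 : p ≠ 2) (hadd : Addv W p) (hG : TypeGOrd W p) (hr : W.analyticRank = 0) :
    ExactLeadingTermAt W p := by
  intro κ γ hκ hγ D
  obtain ⟨hmw, hfin⟩ := hGZK W (by rw [hr]; exact zero_le_one)
  have hmw0 : W.mordellWeilRank = 0 := by rw [hmw, hr]
  haveI : Finite W.sha := hfin
  haveI hE : Finite W.toAffine.Point := W.finite_point_of_rank_zero hmw0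
  obtain ⟨v, hv⟩ := exists_heightOneSpectrum_natCast_mem ℚ p
  obtain ⟨-, -, g, hgmem, -, u, hgeq⟩ := hDelG W p hp2 hadd hG hr hfin hE κ γ hκ hγ v hv D
  have hbot : W.localTowerKerPrimary κ (v.adicCompletion ℚ) 0 = ⊥ := by
    by_cases hirr : Irr W p
    · exact GoodModelLine.ClassX4Gord.localTowerKerPrimary_zero_eq_bot (W := W) (p := p)
        ⟨⟨hp2, hadd, hirr⟩, hG⟩ hv κ
    · exact GoodModelLine.ClassX3Gord.localTowerKerPrimary_zero_eq_bot (W := W) (p := p) hp2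
        ⟨⟨hirr, hadd⟩, hG⟩ hv κ
  have hcard : Nat.card (W.localTowerKerPrimary κ (v.adicCompletion ℚ) 0) = 1 := by
    rw [hbot]; exact AddSubgroup.card_bot
  rw [hcard, Nat.cast_one, mul_one] at hgeq
  exact ⟨g, hgmem, u, hgeq⟩

/-! ## §2 The lower half in analytic rank `0` from the ONE typed input, in each currency -/

/-- **Additive (G)-ordinary locus (any defect), odd `p`, `r_an = 0`: `CycLowerLeadingTermAt W p` ⟹
`ord_p #Ш(E)_an ≤ ord_p #Ш(E)`** (`Typed.MissingLowerBoundAt W p`), from Delbourgo 1998 Prop. 4 intrinsic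
(`hDelG`), GZK (`hGZK`) and modularity (`hmod`: `L(E,s)` entire) — through §1 and the tree's class-agnostic
socket `missingLowerBoundAt_of_cycLowerLeadingTerm_of_exact`. No image, defect, anomaly, CM, Tamagawa or
Manin hypothesis. [cite: Delbourgo1998, Prop. 4 (p. 144) and Main Conjecture (p. 151) (shape of the input)]
[cite: Miller2011LMS, Def. 1.1] -/
theorem missingLowerBoundAt_rankZero_of_cycLowerLeadingTerm_of_typeGOrd
    (hDelG : Delbourgo1998.prop4_rankZero_constantCoeff_eq_unit_mul_of_potGoodOrd)
    (hGZK : rank_eq_analyticRank_of_analyticRank_le_one) (hmod : hasEntireLFunction_rat)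
    (hp2 : p ≠ 2) (hadd : Addv W p) (hG : TypeGOrd W p) (hr : W.analyticRank = 0)
    (hLow : CycLowerLeadingTermAt W p) : MissingLowerBoundAt W p :=
  missingLowerBoundAt_of_cycLowerLeadingTerm_of_exact W p hGZK hmod hr hLow
    (exactLeadingTermAt_of_prop4Intrinsic_of_typeGOrd hDelG hGZK hp2 hadd hG hr)

/-- **Cell (G-ord, `e = 2`), `r_an = 0`: `CycLowerLeadingTermAt W p` ⟹ the lower half** (binders of the
crux's cell predicate `N10.CellGordTwo`). [cite: Delbourgo1998, Prop. 4 (p. 144)] [cite: Miller2011LMS, Def. 1.1] -/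
theorem missingLowerBoundAt_cellGordTwo_rankZero_of_cycLowerLeadingTerm
    (hDelG : Delbourgo1998.prop4_rankZero_constantCoeff_eq_unit_mul_of_potGoodOrd)
    (hGZK : rank_eq_analyticRank_of_analyticRank_le_one) (hmod : hasEntireLFunction_rat)
    (hc : N10.CellGordTwo W p) (hr : W.analyticRank = 0) (hLow : CycLowerLeadingTermAt W p) :
    MissingLowerBoundAt W p :=
  missingLowerBoundAt_rankZero_of_cycLowerLeadingTerm_of_typeGOrd hDelG hGZK hmod hc.1 hc.2.1 hc.2.2.1
    hr hLow

/-- **Cell (G-ord, `e ∈ {3,4,6}`) (the residual corner of crux `GordHigherLower`), `r_an = 0`: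
`CycLowerLeadingTermAt W p` ⟹ the lower half** — the same transport, recorded for the planner: in rank
`0` the corner needs no more than the `I₀*` cell once the `T = 0` lower input is given.
[cite: Delbourgo1998, Prop. 4 (p. 144)] [cite: Miller2011LMS, Def. 1.1] -/
theorem missingLowerBoundAt_cellGordHigher_rankZero_of_cycLowerLeadingTerm
    (hDelG : Delbourgo1998.prop4_rankZero_constantCoeff_eq_unit_mul_of_potGoodOrd)
    (hGZK : rank_eq_analyticRank_of_analyticRank_le_one) (hmod : hasEntireLFunction_rat)
    (hc : N10.CellGordHigher W p) (hr : W.analyticRank = 0) (hLow : CycLowerLeadingTermAt W p) :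
    MissingLowerBoundAt W p :=
  missingLowerBoundAt_rankZero_of_cycLowerLeadingTerm_of_typeGOrd hDelG hGZK hmod hc.1 hc.2.1 hc.2.2.1
    hr hLow

/-- **Cell (G-ord, `e = 2`), `p ≡ 1 (mod 4)`, `r_an = 0`: the EVEN-branch `T = 0` input
`ChiBranchLowerLeadingTermAt W p` ⟹ the lower half** — Birch's formula + Pal 2012 Thm. 3.2 (`hPal`)
identify `L(E,1)/Ω_E` with `±ϖ·∑_{a mod p}(a/p)[a/p]⁺_{f♭}` (tree:
`cycLowerLeadingTermAt_iff_chiBranchLower_of_typeGOrd_of_semistabilityIndex_eq_two`, which needs a modular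
parametrisation datum `hmodD`). [cite: Pal2012, Thm. 3.2] [cite: Delbourgo1998, Prop. 4 (p. 144)]
[cite: Miller2011LMS, Def. 1.1] -/
theorem missingLowerBoundAt_cellGordTwo_rankZero_of_chiBranchLowerLeadingTerm
    (hDelG : Delbourgo1998.prop4_rankZero_constantCoeff_eq_unit_mul_of_potGoodOrd)
    (hPal : Pal2012.thm32_sqrt_mul_realPeriodRat_twist_eq_of_prime_one_mod_four)
    (hGZK : rank_eq_analyticRank_of_analyticRank_le_one) (hmod : hasEntireLFunction_rat)
    (hmodD : nonempty_modularParametrizationData)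
    (hc : N10.CellGordTwo W p) (hp4 : p % 4 = 1) (hr : W.analyticRank = 0)
    (hLow : ChiBranchLowerLeadingTermAt W p) : MissingLowerBoundAt W p :=
  missingLowerBoundAt_cellGordTwo_rankZero_of_cycLowerLeadingTerm hDelG hGZK hmod hc hr
    ((cycLowerLeadingTermAt_iff_chiBranchLower_of_typeGOrd_of_semistabilityIndex_eq_two W p hPal hmod
        hmodD hp4 hc.2.1 hc.2.2.1 hc.2.2.2).mpr hLow)

/-- **Cell (G-ord, `e = 2`), `p ≡ 3 (mod 4)` (`p = 3` included), `r_an = 0`: the ODD-branch `T = 0` input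
`ChiBranchLowerLeadingTermOddAt W p` ⟹ the lower half** (minus symbols, `Ω⁻`; tree:
`cycLowerLeadingTermAt_iff_chiBranchLowerOdd_of_typeGOrd_of_semistabilityIndex_eq_two`).
[cite: Pal2012, Thm. 3.2] [cite: Delbourgo1998, Prop. 4 (p. 144)] [cite: Miller2011LMS, Def. 1.1] -/
theorem missingLowerBoundAt_cellGordTwo_rankZero_of_chiBranchLowerLeadingTermOdd
    (hDelG : Delbourgo1998.prop4_rankZero_constantCoeff_eq_unit_mul_of_potGoodOrd)
    (hGZK : rank_eq_analyticRank_of_analyticRank_le_one) (hmod : hasEntireLFunction_rat)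
    (hmodD : nonempty_modularParametrizationData)
    (hc : N10.CellGordTwo W p) (hp4 : p % 4 = 3) (hr : W.analyticRank = 0)
    (hLow : ChiBranchLowerLeadingTermOddAt W p) : MissingLowerBoundAt W p :=
  missingLowerBoundAt_cellGordTwo_rankZero_of_cycLowerLeadingTerm hDelG hGZK hmod hc hr
    ((cycLowerLeadingTermAt_iff_chiBranchLowerOdd_of_typeGOrd_of_semistabilityIndex_eq_two W p hmod
        hmodD hp4 hc.2.1 hc.2.2.1 hc.2.2.2).mpr hLow)

/-- **Cell (G-ord, `e = 2`), `p ≡ 1 (mod 4)`, `r_an = 0`: the Λ-ADIC even-branch input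
`ChiBranchLowerDivisibilityAt W p` (`char_Λ X(E/ℚ_∞) ⊆ (ϖ·L_p(f♭, α, ω^{(p−1)/2}, T))`) ⟹ the lower
half** — Λ-adic ⟹ `T = 0` by the branch constant term (Mazur–Tate–Teitelbaum §I.14, tree theorem
`chiBranchLowerLeadingTermAt_of_divisibility_of_padicValRat_j_nonneg`; `ord_p j ≥ 0` on (G-ord)).
[cite: MazurTateTeitelbaum1986Invent, §I.14] [cite: Pal2012, Thm. 3.2] [cite: Delbourgo1998, Prop. 4 (p. 144)] -/
theorem missingLowerBoundAt_cellGordTwo_rankZero_of_chiBranchLowerDivisibility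
    (hDelG : Delbourgo1998.prop4_rankZero_constantCoeff_eq_unit_mul_of_potGoodOrd)
    (hPal : Pal2012.thm32_sqrt_mul_realPeriodRat_twist_eq_of_prime_one_mod_four)
    (hGZK : rank_eq_analyticRank_of_analyticRank_le_one) (hmod : hasEntireLFunction_rat)
    (hmodD : nonempty_modularParametrizationData)
    (hc : N10.CellGordTwo W p) (hp4 : p % 4 = 1) (hr : W.analyticRank = 0)
    (hΛ : ChiBranchLowerDivisibilityAt W p) : MissingLowerBoundAt W p :=
  missingLowerBoundAt_cellGordTwo_rankZero_of_chiBranchLowerLeadingTerm hDelG hPal hGZK hmod hmodD hc hp4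
    hr (chiBranchLowerLeadingTermAt_of_divisibility_of_padicValRat_j_nonneg p W
      (padicValRat_j_nonneg_of_typeGOrd W p hc.2.2.1) hΛ)

/-- **Cell (G-ord, `e = 2`), `p ≡ 3 (mod 4)`, `r_an = 0`: the Λ-ADIC odd-branch input
`ChiBranchLowerDivisibilityOddAt W p` ⟹ the lower half** (tree theorem
`chiBranchLowerLeadingTermOddAt_of_divisibilityOdd_of_padicValRat_j_nonneg`).
[cite: MazurTateTeitelbaum1986Invent, §I.14] [cite: Delbourgo1998, Prop. 4 (p. 144)] -/
theorem missingLowerBoundAt_cellGordTwo_rankZero_of_chiBranchLowerDivisibilityOdd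
    (hDelG : Delbourgo1998.prop4_rankZero_constantCoeff_eq_unit_mul_of_potGoodOrd)
    (hGZK : rank_eq_analyticRank_of_analyticRank_le_one) (hmod : hasEntireLFunction_rat)
    (hmodD : nonempty_modularParametrizationData)
    (hc : N10.CellGordTwo W p) (hp4 : p % 4 = 3) (hr : W.analyticRank = 0)
    (hΛ : ChiBranchLowerDivisibilityOddAt W p) : MissingLowerBoundAt W p :=
  missingLowerBoundAt_cellGordTwo_rankZero_of_chiBranchLowerLeadingTermOdd hDelG hGZK hmod hmodD hc hp4
    hr (chiBranchLowerLeadingTermOddAt_of_divisibilityOdd_of_padicValRat_j_nonneg p W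
      (padicValRat_j_nonneg_of_typeGOrd W p hc.2.2.1) hΛ)

/-! ## §3 Route-facing forms: the crux BY NAME and the two registered stubs VERBATIM, from the named facts
and the displayed branch lower input -/

/-- **Crux 19357 from the named facts and the `T = 0` branch lower input on its rows.** IF, on every
pair of cell (G-ord, `e = 2`) in analytic rank `0` WITHOUT a Case-1 member, the main-conjecture lower
bound at `T = 0` (`CycLowerLeadingTermAt W p`: `L(E,1)/Ω_E ∣ f(0)` for every generator `f` of
`char_Λ X(E/ℚ_∞)`) holds, THEN `GordTwoRankZeroOffCaseOne` — by §2, from Delbourgo 1998 Prop. 4 intrinsic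
(`hDelG`), GZK (`hGZK`) and modularity (`hmod`). The conclusion is the route decl by name; the theorem is
CONDITIONAL on the displayed input `hLow` (not in print) and closes nothing.
[cite: Delbourgo1998, Prop. 4 (p. 144) and Main Conjecture (p. 151)] [cite: Miller2011LMS, Def. 1.1] -/
theorem gordTwoRankZeroOffCaseOne_of_cycLowerLeadingTerm
    (hDelG : Delbourgo1998.prop4_rankZero_constantCoeff_eq_unit_mul_of_potGoodOrd)
    (hGZK : rank_eq_analyticRank_of_analyticRank_le_one) (hmod : hasEntireLFunction_rat)
    (hLow : ∀ (W : WeierstrassCurve ℚ) [W.IsElliptic] [W.IsGloballyMinimal] (p : ℕ) [Fact p.Prime],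
      W.analyticRank = 0 → N10.CellGordTwo W p → ¬ HasCaseOneMember W p → CycLowerLeadingTermAt W p) :
    GordTwoRankZeroOffCaseOne := by
  intro W _ _ p _ hr hc hno
  exact missingLowerBoundAt_cellGordTwo_rankZero_of_cycLowerLeadingTerm hDelG hGZK hmod hc hr
    (hLow W p hr hc hno)

/-- **Registered stub `stub_irreducible`, VERBATIM as conclusion, from the named facts and the `T = 0`
lower input on the irreducible rows.** [cite: Delbourgo1998, Prop. 4 (p. 144)] [cite: Miller2011LMS, Def. 1.1] -/
theorem stubIrreducible_of_cycLowerLeadingTerm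
    (hDelG : Delbourgo1998.prop4_rankZero_constantCoeff_eq_unit_mul_of_potGoodOrd)
    (hGZK : rank_eq_analyticRank_of_analyticRank_le_one) (hmod : hasEntireLFunction_rat)
    (hLow : ∀ (W : WeierstrassCurve ℚ) [W.IsElliptic] [W.IsGloballyMinimal] (p : ℕ) [Fact p.Prime],
      W.analyticRank = 0 → N10.CellGordTwo W p → Irr W p → CycLowerLeadingTermAt W p) :
    ∀ (W : WeierstrassCurve ℚ) [W.IsElliptic] [W.IsGloballyMinimal] (p : ℕ) [Fact p.Prime],
      W.analyticRank = 0 → N10.CellGordTwo W p → W.HasIrreducibleModPGaloisRep p →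
        MissingLowerBoundAt W p :=
  fun W _ _ p _ hr hc hirr ↦
    missingLowerBoundAt_cellGordTwo_rankZero_of_cycLowerLeadingTerm hDelG hGZK hmod hc hr
      (hLow W p hr hc hirr)

/-- **Registered stub `stub_reducibleNoCaseOne`, VERBATIM as conclusion, from the named facts and the
`T = 0` lower input on the reducible rows with no Case-1 member** (Greenberg–Vatsal `μ`-territory on the
branch: no printed source; the input stays displayed). [cite: Delbourgo1998, Prop. 4 (p. 144)]
[cite: Miller2011LMS, Def. 1.1] -/
theorem stubReducibleNoCaseOne_of_cycLowerLeadingTerm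
    (hDelG : Delbourgo1998.prop4_rankZero_constantCoeff_eq_unit_mul_of_potGoodOrd)
    (hGZK : rank_eq_analyticRank_of_analyticRank_le_one) (hmod : hasEntireLFunction_rat)
    (hLow : ∀ (W : WeierstrassCurve ℚ) [W.IsElliptic] [W.IsGloballyMinimal] (p : ℕ) [Fact p.Prime],
      W.analyticRank = 0 → N10.CellGordTwo W p → ¬ Irr W p → ¬ HasCaseOneMember W p →
        CycLowerLeadingTermAt W p) :
    ∀ (W : WeierstrassCurve ℚ) [W.IsElliptic] [W.IsGloballyMinimal] (p : ℕ) [Fact p.Prime],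
      W.analyticRank = 0 → N10.CellGordTwo W p → ¬ W.HasIrreducibleModPGaloisRep p →
        ¬ HasCaseOneMember W p → MissingLowerBoundAt W p :=
  fun W _ _ p _ hr hc hred hno ↦
    missingLowerBoundAt_cellGordTwo_rankZero_of_cycLowerLeadingTerm hDelG hGZK hmod hc hr
      (hLow W p hr hc hred hno)

/-- **Crux 19357 from the named facts and the BRANCH `T = 0` inputs, parity-split** (the route's layer-2
shape: `ChiBranchLowerLeadingTermAt` on the `p ≡ 1 (mod 4)` rows, `ChiBranchLowerLeadingTermOddAt` on the
`p ≡ 3 (mod 4)` rows, both off Case-1); Pal 2012 Thm. 3.2 (`hPal`) and a modular parametrisation datum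
(`hmodD`) enter through Birch's formula. CONDITIONAL on the displayed inputs; closes nothing.
[cite: Pal2012, Thm. 3.2] [cite: Delbourgo1998, Prop. 4 (p. 144)] [cite: Miller2011LMS, Def. 1.1] -/
theorem gordTwoRankZeroOffCaseOne_of_chiBranchLowerLeadingTerm
    (hDelG : Delbourgo1998.prop4_rankZero_constantCoeff_eq_unit_mul_of_potGoodOrd)
    (hPal : Pal2012.thm32_sqrt_mul_realPeriodRat_twist_eq_of_prime_one_mod_four)
    (hGZK : rank_eq_analyticRank_of_analyticRank_le_one) (hmod : hasEntireLFunction_rat)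
    (hmodD : nonempty_modularParametrizationData)
    (hEven : ∀ (W : WeierstrassCurve ℚ) [W.IsElliptic] [W.IsGloballyMinimal] (p : ℕ) [Fact p.Prime],
      W.analyticRank = 0 → N10.CellGordTwo W p → ¬ HasCaseOneMember W p → p % 4 = 1 →
        ChiBranchLowerLeadingTermAt W p)
    (hOdd : ∀ (W : WeierstrassCurve ℚ) [W.IsElliptic] [W.IsGloballyMinimal] (p : ℕ) [Fact p.Prime],
      W.analyticRank = 0 → N10.CellGordTwo W p → ¬ HasCaseOneMember W p → p % 4 = 3 →
        ChiBranchLowerLeadingTermOddAt W p) :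
    GordTwoRankZeroOffCaseOne := by
  intro W _ _ p _ hr hc hno
  -- the branch-parity split of the cell: an odd prime is `≡ 1` or `≡ 3 (mod 4)`
  have h4 : p % 4 = 1 ∨ p % 4 = 3 := by
    have := Nat.odd_iff.mp ((Fact.out : p.Prime).odd_of_ne_two hc.1); omega
  rcases h4 with h1 | h3
  · exact missingLowerBoundAt_cellGordTwo_rankZero_of_chiBranchLowerLeadingTerm hDelG hPal hGZK hmod hmodD
      hc h1 hr (hEven W p hr hc hno h1)
  · exact missingLowerBoundAt_cellGordTwo_rankZero_of_chiBranchLowerLeadingTermOdd hDelG hGZK hmod hmodD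
      hc h3 hr (hOdd W p hr hc hno h3)

/-- **Crux 19357 from the named facts and the Λ-ADIC branch inputs, parity-split** — the route's TWO-LAYER
PLAN («GordTwoRankZeroOffCaseOne ⇐ ChiBranchDivisibility on the off-Case-1 rows», glue
`chiBranchLowerLeadingTermAt_of_divisibility_of_padicValRat_j_nonneg ∘ …`), kernel-checked: the main-
conjecture containment `char_Λ X(E/ℚ_∞) ⊆ (L_p^{br})` on the `ω^{(p−1)/2}`-branch of `E♭` (plus /
minus symbols by parity) on every off-Case-1 pair of the cell in analytic rank `0` implies the crux.
CONDITIONAL on the displayed inputs (the Skinner–Urban direction on a non-trivial tame branch — not in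
print); closes nothing. [cite: SkinnerUrban2014, Thm. 3.6.4 (p. 43) (shape of the displayed input)]
[cite: MazurTateTeitelbaum1986Invent, §I.14] [cite: Pal2012, Thm. 3.2] [cite: Delbourgo1998, Prop. 4 (p. 144)] -/
theorem gordTwoRankZeroOffCaseOne_of_chiBranchLowerDivisibility
    (hDelG : Delbourgo1998.prop4_rankZero_constantCoeff_eq_unit_mul_of_potGoodOrd)
    (hPal : Pal2012.thm32_sqrt_mul_realPeriodRat_twist_eq_of_prime_one_mod_four)
    (hGZK : rank_eq_analyticRank_of_analyticRank_le_one) (hmod : hasEntireLFunction_rat)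
    (hmodD : nonempty_modularParametrizationData)
    (hΛEven : ∀ (W : WeierstrassCurve ℚ) [W.IsElliptic] [W.IsGloballyMinimal] (p : ℕ) [Fact p.Prime],
      W.analyticRank = 0 → N10.CellGordTwo W p → ¬ HasCaseOneMember W p → p % 4 = 1 →
        ChiBranchLowerDivisibilityAt W p)
    (hΛOdd : ∀ (W : WeierstrassCurve ℚ) [W.IsElliptic] [W.IsGloballyMinimal] (p : ℕ) [Fact p.Prime],
      W.analyticRank = 0 → N10.CellGordTwo W p → ¬ HasCaseOneMember W p → p % 4 = 3 →
        ChiBranchLowerDivisibilityOddAt W p) :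
    GordTwoRankZeroOffCaseOne := by
  intro W _ _ p _ hr hc hno
  have h4 : p % 4 = 1 ∨ p % 4 = 3 := by
    have := Nat.odd_iff.mp ((Fact.out : p.Prime).odd_of_ne_two hc.1); omega
  rcases h4 with h1 | h3
  · exact missingLowerBoundAt_cellGordTwo_rankZero_of_chiBranchLowerDivisibility hDelG hPal hGZK hmod
      hmodD hc h1 hr (hΛEven W p hr hc hno h1)
  · exact missingLowerBoundAt_cellGordTwo_rankZero_of_chiBranchLowerDivisibilityOdd hDelG hGZK hmod hmodD
      hc h3 hr (hΛOdd W p hr hc hno h3)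

/-- **With the route's facts packaged**: `PrintedFacts → ReadingFacts → (T = 0 lower input on the
off-Case-1 rows) → GordTwoRankZeroOffCaseOne` — the shape the route's Assembly consumes (only the
conjuncts `hGZK`, `hmod` of `PrintedFacts` and `hDelG` of `ReadingFacts` are used).
[cite: Delbourgo1998, Prop. 4 (p. 144)] [cite: Miller2011LMS, Def. 1.1] -/
theorem gordTwoRankZeroOffCaseOne_of_facts_of_cycLowerLeadingTerm
    (hP : PrintedFacts) (hR : ReadingFacts)
    (hLow : ∀ (W : WeierstrassCurve ℚ) [W.IsElliptic] [W.IsGloballyMinimal] (p : ℕ) [Fact p.Prime],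
      W.analyticRank = 0 → N10.CellGordTwo W p → ¬ HasCaseOneMember W p → CycLowerLeadingTermAt W p) :
    GordTwoRankZeroOffCaseOne :=
  gordTwoRankZeroOffCaseOne_of_cycLowerLeadingTerm hR.2.2.2.2 hP.2.2.2.2.1 hP.2.2.2.2.2.1 hLow

/-! ## §4 What the one ANNOUNCED source gives on the irreducible rows, with §1 (anomalous and CM rows included) -/

/-- **IF the BSTW Thm. 9.21(c) twist clause (tree OPEN hypothesis, unrefereed; read at `T = 0`) holds,
then `stub_irreducible` holds on its slice {`p ≥ 5`, a (ram) prime `ℓ ≠ p`}: for `W` globally minimal,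
`r_an = 0`, `(E,p)` in cell (G-ord, `e = 2`), `E[p]` irreducible, `p ≥ 5`, `Ram W p` ⇒
`ord_p #Ш(E)_an ≤ ord_p #Ш(E)`** — from `hDelG`, GZK, modularity via §2. Compared with the tree's
`N10.missingLowerBoundAt_cellGordTwo_of_BSTW121c_twist_OPEN` (Delbourgo 2002 transport) the inputs
`¬ W.HasCM` and `Delbourgo2002.ReductionNonAnomalous W p` are GONE. Conditional on an unrefereed claim;
closes nothing; books nothing. [claim: BurungaleSkinnerTianWan2024, status: under-review]
[cite: Delbourgo1998, Prop. 4 (p. 144)] [cite: Miller2011LMS, Def. 1.1] -/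
theorem missingLowerBoundAt_cellGordTwo_of_BSTW921c_twist_OPEN_of_prop4Intrinsic
    (hO : BurungaleSkinnerTianWan2024_thm121c_twist_cycLower_OPEN)
    (hDelG : Delbourgo1998.prop4_rankZero_constantCoeff_eq_unit_mul_of_potGoodOrd)
    (hGZK : rank_eq_analyticRank_of_analyticRank_le_one) (hmod : hasEntireLFunction_rat)
    (hp5 : 5 ≤ p) (hr : W.analyticRank = 0) (hc : N10.CellGordTwo W p) (hirr : Irr W p)
    (hram : Ram W p) : MissingLowerBoundAt W p :=
  missingLowerBoundAt_cellGordTwo_rankZero_of_cycLowerLeadingTerm hDelG hGZK hmod hc hr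
    (hO W p hp5 hr hc hirr hram)

/-- **Slice form of `stub_irreducible` modulo the announced source**: IF the BSTW twist clause (OPEN)
holds, then for every pair of cell (G-ord, `e = 2`) in analytic rank `0` with `E[p]` irreducible,
`p ≥ 5` and a (ram) prime, the lower half holds (from `hDelG`, `hGZK`, `hmod`). The rows of
`stub_irreducible` OUTSIDE this slice — `p = 3`, or no prime `ℓ ‖ N_E` with `p ∤ ord_ℓ Δ_E` — have no
printed or announced source (census of record: X4♯(G-ord, `e = 2`, `p ≥ 5`) ∧ (ram), `r = 0`:
214 ‖ 44 window pairs of 218 ‖ 45, file `N10TwistClauseBSTW121c`). [claim: BurungaleSkinnerTianWan2024, status: under-review]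
[cite: Delbourgo1998, Prop. 4 (p. 144)] [cite: Miller2011LMS, Def. 1.1] -/
theorem stubIrreducible_slice_of_BSTW921c_twist_OPEN
    (hO : BurungaleSkinnerTianWan2024_thm121c_twist_cycLower_OPEN)
    (hDelG : Delbourgo1998.prop4_rankZero_constantCoeff_eq_unit_mul_of_potGoodOrd)
    (hGZK : rank_eq_analyticRank_of_analyticRank_le_one) (hmod : hasEntireLFunction_rat) :
    ∀ (W : WeierstrassCurve ℚ) [W.IsElliptic] [W.IsGloballyMinimal] (p : ℕ) [Fact p.Prime],
      W.analyticRank = 0 → N10.CellGordTwo W p → W.HasIrreducibleModPGaloisRep p →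
        5 ≤ p → Ram W p → MissingLowerBoundAt W p :=
  fun _ _ _ _ _ hr hc hirr hp5 hram ↦
    missingLowerBoundAt_cellGordTwo_of_BSTW921c_twist_OPEN_of_prop4Intrinsic hO hDelG hGZK hmod hp5 hr hc
      hirr hram

end Summit.BirchSwinnertonDyer.BirchSwinnertonDyer.Theorems.AdditiveBranchIMCGordTwoRankZeroTransport

end
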